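import Mathlib
import Summits.Ventures.PercRepro2.XWKFiveSub

/-!
# (XW) on `K₅`: certificate slice 05 of 16 (PercRepro2, p2 g24)

The decided sums of `XWKFiveSub.lean` for the free-edge masks `m ∈ [256, 320)`: for every
point mass `k` cleared on `m`, the negative part of the antipodal coefficient at the placement
`s, y, o, u = 0, 1, 2, 3` never exceeds the positive part (`negSum k m ≤ posSum k m`).  One
kernel `decide` over the minors of `K₅` with these free-edge masks and all their colouring pairs;
the sixteen slices are assembled in `XWKFive.lean`.
-/

namespace Summit.Ventures.PercRepro2

namespace XWKFive

set_option maxHeartbeats 0 in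
set_option maxRecDepth 100000 in
/-- The decided sums for the free-edge masks `m ∈ [256, 320)`. -/
theorem sums_slice05 : ∀ m, 256 ≤ m → m < 320 → ∀ k < 1024, k &&& m = 0 →
    negSum k m ≤ posSum k m := by
  decide +kernel

end XWKFive

end Summit.Ventures.PercRepro2
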